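import Literature.MathematicalPhysics.QuantumManyBody.NeumannBoxParseval
import Literature.MathematicalPhysics.QuantumManyBody.NeumannBoseGasCondensationProofs
import HarnessLib

/-!
# The momentum cut-offs `𝒫_L`, `𝒫_H` of the Neumann box and the kinetic spectral gaps

Topic `Literature/MathematicalPhysics/QuantumManyBody`, grouping namespace `NeumannBox` (provefact
`Literature.MathematicalPhysics.QuantumManyBody.BoseGas.Junge2026_neumannBox_pinnedLowerBound`;
fourth brick of the operator layer of [FournaisEtAl2024, §2], resting on `NeumannBoxParseval.lean`).
[FournaisEtAl2024, §2.3] splits the one-particle space `L²(Λ)`, `Λ = [0,ℓ]³`, by the spectral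
projections of the Neumann Laplacian,
`𝒫_L = {p ∈ (π/ℓ)ℕ₀³ : 0 < |p| ≤ K_H ℓ⁻¹}`, `𝒫_H = {|p| > K_H ℓ⁻¹}` (2.10),
`Q^L = 1_{𝒫_L}(√-Δ)`, `Q^H = 1_{𝒫_H}(√-Δ)`, `n₊^L = ∑ⱼ Q^Lⱼ`, `n₊^H = ∑ⱼ Q^Hⱼ` (2.11), so that
`P + Q^L + Q^H = 1`, `n₊ = n₊^L + n₊^H`, and extracts from the kinetic energy the **spectral gaps**
`𝒯 = -Δ - (π/2ℓ²)Q - (K_H/ℓ²)Q^H ≥ 0` (2.12), the positivity reservoir `G` of Theorem 2.3. This file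
vendors these objects at the level the tree works at — expectations in `C¹` wave functions on the
box, exactly as `condensateOccupation`, `depletion` and `kineticDensity` — with real definitions
and the two structural facts PROVED with sharp constants:

* `lowModes K` (a `Finset`: in index space `𝒫_L` reads `k ≠ 0 ∧ π²|k|² ≤ K_H²`, the side `ℓ`
  cancels), `IsHighMode K k` (`π²|k|² > K_H²`), the trichotomy
  `eq_zero_or_mem_lowModes_or_isHighMode` and the splitting of mode sums
  `tsum_eq_zero_add_sum_lowModes_add_tsum_high`;
* one body: `modeCoeff ℓ k f = ⟨u_k, f⟩_{L²(Λ)}`, `lowOccupation K ℓ f = ⟨f, Q^L f⟩`,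
  `highOccupation K ℓ f = ⟨f, Q^H f⟩`; **`P + Q^L + Q^H = 1`**:
  `|⟨u_0,f⟩|² + ⟨f,Q^Lf⟩ + ⟨f,Q^Hf⟩ = ‖f‖²`
  (`enorm_sq_modeCoeff_zero_add_lowOccupation_add_highOccupation`, Parseval) and
  `⟨f,Q^Lf⟩ + ⟨f,Q^Hf⟩ = ‖f - ⟨f⟩_Λ‖² = ⟨f,Qf⟩` (`lowOccupation_add_highOccupation_eq`);
  **the gaps** `(π/ℓ)²⟨f,Q^Lf⟩ + (K_H/ℓ)²⟨f,Q^Hf⟩ ≤ ∫_Λ|∇f|²`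
  (`gap_mul_lowOccupation_add_mul_highOccupation_le`, the form identity: `|p| ≥ π/ℓ` on `𝒫_L`,
  `|p| > K_H/ℓ` on `𝒫_H`);
* `N` bodies: `nPlusLow K ℓ N Ψ = ⟨Ψ, n₊^L Ψ⟩`, `nPlusHigh K ℓ N Ψ = ⟨Ψ, n₊^H Ψ⟩` (sliced like
  `depletion`), **`n₊ = n₊^L + n₊^H`** (`depletion_eq_nPlusLow_add_nPlusHigh`),
  **`n₀ + n₊^L + n₊^H = N`** for normalised Bose-symmetric Neumann states
  (`condensateOccupation_add_nPlusLow_add_nPlusHigh`), and **the gaps summed over the particles**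
  `(π/ℓ)²⟨Ψ,n₊^LΨ⟩ + (K_H/ℓ)²⟨Ψ,n₊^HΨ⟩ ≤ ∫_{Λ^N}|∇Ψ|² ≤ ⟨Ψ, H_N Ψ⟩`
  (`gap_mul_nPlusLow_add_mul_nPlusHigh_le`, `…_le_neumannEnergy`), whence
  `⟨Ψ,n₊^HΨ⟩ ≤ (ℓ/K_H)²⟨Ψ,TΨ⟩` (`nPlusHigh_le_mul_lintegral_kineticDensity`).

The printed (2.12) keeps only `π/(2ℓ²) ≤ ½(π/ℓ)²` and `K_H/ℓ² ≤ ½ K_H²/ℓ²` (`K_H ≥ 2`) of these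
gaps inside `𝒯`; the statements here are the sharp form from which any such split follows.

## References

* [FournaisEtAl2024] S. Fournais, L. Junge, T. Girardot, L. Morin, M. Olivieri, A. Triay, *The free
  energy of dilute Bose gases at low temperatures interacting via strong potentials*,
  arXiv:2408.14222, Ann. Henri Poincaré (2026): (2.9)–(2.12), (2.20)–(2.21), Thm. 2.3.
* [LSSY2005] E. H. Lieb, R. Seiringer, J. P. Solovej, J. Yngvason, *The Mathematics of the Bose Gas
  and its Condensation*, Birkhäuser 2005: Ch. 2, after (2.50); Ch. 5 (5.17).
-/

noncomputable section

open Real intervalIntegral MeasureTheory Set Filter Topology Complex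
open scoped ENNReal NNReal

namespace Literature.MathematicalPhysics.QuantumManyBody.NeumannBox

/-! ### `𝒫_L` and `𝒫_H` in index space -/

section Cutoffs

open Literature.MathematicalPhysics.QuantumManyBody.BoseGas
open Literature.Barriers.AtomisticToContinuum.BoseGas (lintegral_nnnorm_sq_cell_eq depletion)

/-- `|p|² = ∑ᵢ (kᵢπ/ℓ)² = (π/ℓ)²|k|²` for `p = (π/ℓ)k`. [cite: FournaisEtAl2024, (2.10)] -/
theorem sum_waveNumber_sq (ℓ : ℝ) (k : Fin 3 → ℕ) :
    ∑ i, waveNumber ℓ (k i) ^ 2 = (π / ℓ) ^ 2 * ∑ i, (k i : ℝ) ^ 2 := by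
  simp only [waveNumber, Finset.mul_sum]
  exact Finset.sum_congr rfl fun i _ => by ring

/-- For `k ≠ 0`, `|k|² ≥ 1`. [folklore] -/
theorem one_le_sum_sq_of_ne_zero {k : Fin 3 → ℕ} (hk : k ≠ 0) : (1 : ℝ) ≤ ∑ i, (k i : ℝ) ^ 2 := by
  obtain ⟨i, hi⟩ : ∃ i, k i ≠ 0 := Function.ne_iff.1 hk
  have hki : (1 : ℝ) ≤ k i := by exact_mod_cast Nat.one_le_iff_ne_zero.2 hi
  have h1 : (1 : ℝ) ≤ (k i : ℝ) ^ 2 := by nlinarith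
  exact h1.trans (Finset.single_le_sum (f := fun j => ((k j : ℝ)) ^ 2) (fun j _ => sq_nonneg _)
    (Finset.mem_univ i))

open scoped Classical in
/-- **The low momenta `𝒫_L`** of [FournaisEtAl2024, (2.10)] in index space: the multi-indices
`k ∈ ℕ₀³` with `0 < |p| ≤ K_H ℓ⁻¹` for `p = (π/ℓ)k`, i.e. `k ≠ 0` and `π²|k|² ≤ K_H²` (the side
`ℓ` cancels) — a finite set. [cite: FournaisEtAl2024, (2.10)] -/
def lowModes (K : ℝ) : Finset (Fin 3 → ℕ) :=
  (Fintype.piFinset fun _ : Fin 3 => Finset.range (⌈K⌉₊ + 1)).filter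
    fun k => k ≠ 0 ∧ π ^ 2 * ∑ i, (k i : ℝ) ^ 2 ≤ K ^ 2

/-- **The high momenta `𝒫_H`** of [FournaisEtAl2024, (2.10)] in index space: `|p| > K_H ℓ⁻¹`,
i.e. `π²|k|² > K_H²`. [cite: FournaisEtAl2024, (2.10)] -/
def IsHighMode (K : ℝ) (k : Fin 3 → ℕ) : Prop :=
  K ^ 2 < π ^ 2 * ∑ i, (k i : ℝ) ^ 2

/-- Membership in `𝒫_L` (`K ≥ 0`). [cite: FournaisEtAl2024, (2.10)] -/
theorem mem_lowModes {K : ℝ} (hK : 0 ≤ K) {k : Fin 3 → ℕ} :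
    k ∈ lowModes K ↔ k ≠ 0 ∧ π ^ 2 * ∑ i, (k i : ℝ) ^ 2 ≤ K ^ 2 := by
  classical
  rw [lowModes, Finset.mem_filter]
  refine ⟨fun h => h.2, fun h => ⟨Fintype.mem_piFinset.2 fun i => Finset.mem_range.2 ?_, h⟩⟩
  have hsum : (k i : ℝ) ^ 2 ≤ ∑ j, (k j : ℝ) ^ 2 :=
    Finset.single_le_sum (f := fun j => ((k j : ℝ)) ^ 2) (fun j _ => sq_nonneg _)
      (Finset.mem_univ i)
  have hπ : (1 : ℝ) ≤ π ^ 2 := by nlinarith [Real.pi_gt_three]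
  have h1 : (k i : ℝ) ^ 2 ≤ K ^ 2 := by nlinarith [h.2, sq_nonneg (k i : ℝ)]
  have h2 : (k i : ℝ) ≤ K := (sq_le_sq₀ (Nat.cast_nonneg _) hK).1 h1
  have h3 : (k i : ℝ) ≤ (⌈K⌉₊ : ℝ) := h2.trans (Nat.le_ceil K)
  exact Nat.lt_succ_of_le (by exact_mod_cast h3)

/-- The zero mode is neither low … [cite: FournaisEtAl2024, (2.10)] -/
theorem zero_not_mem_lowModes (K : ℝ) : (0 : Fin 3 → ℕ) ∉ lowModes K := by
  classical
  simp [lowModes, Finset.mem_filter]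

/-- … nor high (`K ≥ 0` not even needed: `K² ≥ 0 = π²|0|²`). [cite: FournaisEtAl2024, (2.10)] -/
theorem not_isHighMode_zero (K : ℝ) : ¬ IsHighMode K 0 := by
  simp [IsHighMode, sq_nonneg]

/-- Low and high are disjoint. [cite: FournaisEtAl2024, (2.10)] -/
theorem not_isHighMode_of_mem_lowModes {K : ℝ} (hK : 0 ≤ K) {k : Fin 3 → ℕ}
    (hk : k ∈ lowModes K) : ¬ IsHighMode K k := by
  rw [mem_lowModes hK] at hk
  exact not_lt.2 hk.2

/-- **`P + Q^L + Q^H = 1`** at the level of indices: every `k` is `0`, low, or high (`K ≥ 0`).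
[cite: FournaisEtAl2024, after (2.11)] -/
theorem eq_zero_or_mem_lowModes_or_isHighMode {K : ℝ} (hK : 0 ≤ K) (k : Fin 3 → ℕ) :
    k = 0 ∨ k ∈ lowModes K ∨ IsHighMode K k := by
  by_cases hk : k = 0
  · exact Or.inl hk
  · by_cases hle : π ^ 2 * ∑ i, (k i : ℝ) ^ 2 ≤ K ^ 2
    · exact Or.inr (Or.inl ((mem_lowModes hK).2 ⟨hk, hle⟩))
    · exact Or.inr (Or.inr (not_le.1 hle))

/-- **Splitting a sum over all modes** into the zero mode, `𝒫_L` and `𝒫_H` (`ℝ≥0∞`, `K ≥ 0`).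
[cite: FournaisEtAl2024, after (2.11)] -/
theorem tsum_eq_zero_add_sum_lowModes_add_tsum_high {K : ℝ} (hK : 0 ≤ K)
    (F : (Fin 3 → ℕ) → ℝ≥0∞) :
    ∑' k, F k = F 0 + ∑ k ∈ lowModes K, F k +
      ∑' k, {k | IsHighMode K k}.indicator F k := by
  classical
  have hpt : ∀ k, F k = ({0} : Set (Fin 3 → ℕ)).indicator F k +
      ((lowModes K : Set (Fin 3 → ℕ)).indicator F k + {k | IsHighMode K k}.indicator F k) := by
    intro k
    rcases eq_zero_or_mem_lowModes_or_isHighMode hK k with rfl | hk | hk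
    · simp [zero_not_mem_lowModes, not_isHighMode_zero]
    · have h0 : k ≠ 0 := ((mem_lowModes hK).1 hk).1
      simp [hk, h0, not_isHighMode_of_mem_lowModes hK hk]
    · have h0 : k ≠ 0 := fun h => not_isHighMode_zero K (h ▸ hk)
      have hl : k ∉ lowModes K := fun h => not_isHighMode_of_mem_lowModes hK h hk
      simp [hk, h0, hl]
  rw [tsum_congr hpt, ENNReal.tsum_add, ENNReal.tsum_add, ← sum_eq_tsum_indicator, ← add_assoc]
  congr 2
  rw [tsum_eq_single (0 : Fin 3 → ℕ) fun k hk => by simp [hk]]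
  simp

/-! ### One-body occupations of the low and high modes -/

/-- The coefficient `⟨u_k, f⟩ = ∫_Λ u_k f` of a one-body function in the Neumann eigenbasis
(`u_k` is real), on the cell `Λ = [0,ℓ)³`. [cite: FournaisEtAl2024, (2.20)] -/
def modeCoeff (ℓ : ℝ) (k : Fin 3 → ℕ) (f : Space → ℂ) : ℂ :=
  ∫ x in cell ℓ, (mode ℓ k x : ℂ) * f x

/-- **`⟨f, Q^L f⟩`**: the occupation `∑_{p ∈ 𝒫_L} |⟨u_p, f⟩|²` of the low momenta,
`Q^L = 1_{𝒫_L}(√-Δ)`. [cite: FournaisEtAl2024, (2.10)–(2.11)] -/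
def lowOccupation (K ℓ : ℝ) (f : Space → ℂ) : ℝ≥0∞ :=
  ∑ k ∈ lowModes K, ‖modeCoeff ℓ k f‖ₑ ^ 2

/-- **`⟨f, Q^H f⟩`**: the occupation `∑_{p ∈ 𝒫_H} |⟨u_p, f⟩|²` of the high momenta,
`Q^H = 1_{𝒫_H}(√-Δ)`. [cite: FournaisEtAl2024, (2.10)–(2.11)] -/
def highOccupation (K ℓ : ℝ) (f : Space → ℂ) : ℝ≥0∞ :=
  ∑' k, {k | IsHighMode K k}.indicator (fun k => ‖modeCoeff ℓ k f‖ₑ ^ 2) k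

/-- The open box and the half-open cell agree a.e. [folklore] -/
theorem box_ae_eq_cell (ℓ : ℝ) : box ℓ =ᵐ[volume] cell ℓ := by
  have hmp : MeasurePreserving (MeasurableEquiv.toLp 2 (Fin 3 → ℝ)).symm volume volume :=
    EuclideanSpace.volume_preserving_symm_measurableEquiv_toLp (Fin 3)
  have hcell : cell ℓ = (MeasurableEquiv.toLp 2 (Fin 3 → ℝ)).symm ⁻¹'
      (Set.pi univ fun _ => Ico (0 : ℝ) ℓ) := by
    ext x; simp [cell, MeasurableEquiv.coe_toLp_symm]
  rw [box_eq_preimage_toLp_symm, hcell]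
  refine hmp.quasiMeasurePreserving.preimage_ae_eq ?_
  rw [volume_pi]
  exact Measure.univ_pi_Ioo_ae_eq_Icc.trans Measure.univ_pi_Ico_ae_eq_Icc.symm

/-- `⟨u_k, f⟩` over the cell equals the coefficient over the open box. [folklore] -/
theorem modeCoeff_eq_setIntegral_box (ℓ : ℝ) (k : Fin 3 → ℕ) (f : Space → ℂ) :
    modeCoeff ℓ k f = ∫ x in box ℓ, (mode ℓ k x : ℂ) * f x :=
  (setIntegral_congr_set (box_ae_eq_cell ℓ)).symm

/-- **Parseval on the cell**: `∑_k |⟨u_k, f⟩|² = ‖f‖²_{L²(Λ)}` for continuous `f`.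
[cite: FournaisEtAl2024, (2.20)] -/
theorem tsum_enorm_sq_modeCoeff {ℓ : ℝ} (hℓ : 0 < ℓ) {f : Space → ℂ} (hf : Continuous f) :
    ∑' k, ‖modeCoeff ℓ k f‖ₑ ^ 2 = ∫⁻ x in cell ℓ, ‖f x‖ₑ ^ 2 := by
  simp_rw [modeCoeff_eq_setIntegral_box]
  rw [tsum_enorm_sq_setIntegral_box_mode_mul hℓ hf, setLIntegral_congr (box_ae_eq_cell ℓ)]

/-- **The Neumann form on the cell is diagonal**: `∑_k |p|² |⟨u_k, f⟩|² = ∫_Λ |∇f|²` for `f ∈ C¹`,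
with `|∇f|² = gradSqC f`. [cite: FournaisEtAl2024, (2.20)–(2.21)] -/
theorem tsum_sum_waveNumber_sq_mul_enorm_sq_modeCoeff {ℓ : ℝ} (hℓ : 0 < ℓ) {f : Space → ℂ}
    (hf : ContDiff ℝ 1 f) :
    ∑' k, ENNReal.ofReal (∑ i, waveNumber ℓ (k i) ^ 2) * ‖modeCoeff ℓ k f‖ₑ ^ 2 =
      ∫⁻ x in cell ℓ, gradSqC f x := by
  simp_rw [modeCoeff_eq_setIntegral_box]
  rw [tsum_sum_waveNumber_sq_mul_enorm_sq_setIntegral_box_mode_mul hℓ hf,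
    setLIntegral_congr (box_ae_eq_cell ℓ)]
  rfl

/-- **`⟨f, Pf⟩ + ⟨f, Q^Lf⟩ + ⟨f, Q^Hf⟩ = ‖f‖²`** (`P + Q^L + Q^H = 1` in expectation): for
continuous `f`, `K ≥ 0`, `|⟨u_0,f⟩|² + lowOccupation + highOccupation = ∫_Λ|f|²`.
[cite: FournaisEtAl2024, after (2.11)] -/
theorem enorm_sq_modeCoeff_zero_add_lowOccupation_add_highOccupation {K ℓ : ℝ} (hK : 0 ≤ K)
    (hℓ : 0 < ℓ) {f : Space → ℂ} (hf : Continuous f) :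
    ‖modeCoeff ℓ 0 f‖ₑ ^ 2 + lowOccupation K ℓ f + highOccupation K ℓ f =
      ∫⁻ x in cell ℓ, ‖f x‖ₑ ^ 2 := by
  rw [← tsum_enorm_sq_modeCoeff hℓ hf,
    tsum_eq_zero_add_sum_lowModes_add_tsum_high hK fun k => ‖modeCoeff ℓ k f‖ₑ ^ 2]
  rfl

/-- **The kinetic spectral gaps** ((2.12): `𝒯 = -Δ - (π/2ℓ²)Q - (K_H/ℓ²)Q^H ≥ 0`, here with
the sharp constants): for `f ∈ C¹` and `K ≥ 0`,
`(π/ℓ)² ⟨f, Q^L f⟩ + (K/ℓ)² ⟨f, Q^H f⟩ ≤ ∫_Λ |∇f|²` — low modes have `|p|² ≥ (π/ℓ)²`, high ones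
`|p|² > K²/ℓ²`. [cite: FournaisEtAl2024, (2.12)] -/
theorem gap_mul_lowOccupation_add_mul_highOccupation_le {K ℓ : ℝ} (hK : 0 ≤ K) (hℓ : 0 < ℓ)
    {f : Space → ℂ} (hf : ContDiff ℝ 1 f) :
    ENNReal.ofReal ((π / ℓ) ^ 2) * lowOccupation K ℓ f +
        ENNReal.ofReal ((K / ℓ) ^ 2) * highOccupation K ℓ f ≤
      ∫⁻ x in cell ℓ, gradSqC f x := by
  rw [← tsum_sum_waveNumber_sq_mul_enorm_sq_modeCoeff hℓ hf,
    tsum_eq_zero_add_sum_lowModes_add_tsum_high hK, lowOccupation, highOccupation,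
    Finset.mul_sum, ← ENNReal.tsum_mul_left, add_assoc]
  refine le_add_left (add_le_add (Finset.sum_le_sum fun k hk => ?_)
    (ENNReal.tsum_le_tsum fun k => ?_))
  · have hreal : (π / ℓ) ^ 2 ≤ ∑ i, waveNumber ℓ (k i) ^ 2 := by
      rw [sum_waveNumber_sq]
      have h1 := one_le_sum_sq_of_ne_zero ((mem_lowModes hK).1 hk).1
      have h0 : 0 ≤ (π / ℓ) ^ 2 := sq_nonneg _
      nlinarith
    gcongr
  · by_cases hk : IsHighMode K k
    · simp only [Set.indicator_of_mem (show k ∈ {k | IsHighMode K k} from hk)]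
      have hreal : (K / ℓ) ^ 2 ≤ ∑ i, waveNumber ℓ (k i) ^ 2 := by
        rw [sum_waveNumber_sq, div_pow, div_pow, div_mul_eq_mul_div]
        exact div_le_div_of_nonneg_right (le_of_lt hk) (sq_nonneg _)
      gcongr
    · simp [Set.indicator_of_notMem (show k ∉ {k | IsHighMode K k} from hk)]

/-- The zero-mode coefficient is the box average: `|⟨u_0, f⟩|² = ℓ⁻³|∫_Λ f|²`.
[cite: FournaisEtAl2024, (2.9)] -/
theorem enorm_sq_modeCoeff_zero {ℓ : ℝ} (hℓ : 0 < ℓ) (f : Space → ℂ) :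
    ‖modeCoeff ℓ 0 f‖ₑ ^ 2 = (ENNReal.ofReal ℓ ^ 3)⁻¹ * ‖∫ x in cell ℓ, f x‖ₑ ^ 2 := by
  have h1 : modeCoeff ℓ 0 f = (((1 / Real.sqrt ℓ) ^ 3 : ℝ) : ℂ) * ∫ x in cell ℓ, f x := by
    rw [modeCoeff, ← MeasureTheory.integral_const_mul]
    congr 1; funext x; rw [mode_zero]
  have hℓ3 : (0 : ℝ) < ℓ ^ 3 := by positivity
  have h2 : ((1 / Real.sqrt ℓ) ^ 3) ^ 2 = (ℓ ^ 3)⁻¹ := by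
    rw [← pow_mul, show 3 * 2 = 2 * 3 by norm_num, pow_mul, div_pow, one_pow,
      Real.sq_sqrt hℓ.le, one_div, inv_pow]
  rw [h1, enorm_mul, mul_pow, ← ofReal_norm, Complex.norm_real, Real.norm_eq_abs,
    abs_of_pos (by positivity), ← ENNReal.ofReal_pow (by positivity), h2,
    ← ENNReal.ofReal_pow hℓ.le, ← ENNReal.ofReal_inv_of_pos hℓ3]

/-- **`⟨f, Qf⟩ = ⟨f, Q^Lf⟩ + ⟨f, Q^Hf⟩`** in variance form: for continuous `f` and `K ≥ 0`,
`lowOccupation + highOccupation = ∫_Λ |f - ⟨f⟩_Λ|²` (`Q = 1 - P` projects off the constants;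
`n₊ = n₊^L + n₊^H`). [cite: FournaisEtAl2024, after (2.11)] -/
theorem lowOccupation_add_highOccupation_eq {K ℓ : ℝ} (hK : 0 ≤ K) (hℓ : 0 < ℓ) {f : Space → ℂ}
    (hf : Continuous f) :
    lowOccupation K ℓ f + highOccupation K ℓ f =
      ∫⁻ x in cell ℓ, ‖f x - ⨍ y in cell ℓ, f y‖ₑ ^ 2 := by
  have h := enorm_sq_modeCoeff_zero_add_lowOccupation_add_highOccupation hK hℓ hf
  have hvar := lintegral_nnnorm_sq_cell_eq hℓ hf
  rw [enorm_sq_modeCoeff_zero hℓ, add_assoc] at h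
  simp only [enorm_eq_nnnorm] at h ⊢
  rw [hvar, add_comm (∫⁻ x in cell ℓ, _) _] at h
  exact (ENNReal.add_right_inj (ENNReal.mul_ne_top (ENNReal.inv_ne_top.2
    (pow_ne_zero _ (by simpa using hℓ))) (ENNReal.pow_ne_top ENNReal.coe_ne_top))).1 h

end Cutoffs

/-! ### `N`-body level: `⟨Ψ, n₊^L Ψ⟩`, `⟨Ψ, n₊^H Ψ⟩`, `n₀ + n₊^L + n₊^H = N`, and the gaps -/

section NBody

open Literature.MathematicalPhysics.QuantumManyBody.BoseGas
open Literature.Barriers.AtomisticToContinuum.BoseGas (lintegral_nnnorm_sq_cell_eq depletion)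

variable {N : ℕ}

/-- The product modes are continuous. [folklore] -/
theorem continuous_mode (ℓ : ℝ) (k : Fin 3 → ℕ) : Continuous (mode ℓ k) := by
  unfold mode
  exact continuous_finsetProd _ fun i _ =>
    (contDiff_cosMode ℓ (k i) (k := 0)).continuous.comp (by fun_prop : Continuous fun x : Space => x i)

/-- **`⟨Ψ, n₊^L Ψ⟩ = ∑ⱼ ⟨Ψ, Q^L_j Ψ⟩`** for an `N`-body function on the Neumann box, the `j`-th
term written as `ℓ⁻³ ∫_{Λ^N} ⟨Ψ(X;·ⱼ), Q^L Ψ(X;·ⱼ)⟩ dX` with the slice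
`Ψ(X;·ⱼ) = y ↦ Ψ(x₁,…,x_{j-1},y,x_{j+1},…)` (the integrand does not depend on `xⱼ`, `|Λ| = ℓ³`;
same bookkeeping as `depletion`). [cite: FournaisEtAl2024, (2.11)] -/
def nPlusLow (K ℓ : ℝ) (N : ℕ) (Ψ : Config N → ℂ) : ℝ≥0∞ :=
  ∑ i : Fin N, (ENNReal.ofReal ℓ ^ 3)⁻¹ *
    ∫⁻ X in cellN N ℓ, lowOccupation K ℓ fun y => Ψ (Function.update X i y)

/-- **`⟨Ψ, n₊^H Ψ⟩ = ∑ⱼ ⟨Ψ, Q^H_j Ψ⟩`** (as `nPlusLow`, with `Q^H`). [cite: FournaisEtAl2024, (2.11)] -/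
def nPlusHigh (K ℓ : ℝ) (N : ℕ) (Ψ : Config N → ℂ) : ℝ≥0∞ :=
  ∑ i : Fin N, (ENNReal.ofReal ℓ ^ 3)⁻¹ *
    ∫⁻ X in cellN N ℓ, highOccupation K ℓ fun y => Ψ (Function.update X i y)

/-- Measurability of the slice coefficients `X ↦ ⟨u_k, Ψ(X;·ᵢ)⟩`. [folklore] -/
theorem measurable_modeCoeff_update (ℓ : ℝ) (k : Fin 3 → ℕ) (i : Fin N) {Ψ : Config N → ℂ}
    (hΨ : Continuous Ψ) :
    Measurable fun X : Config N => modeCoeff ℓ k fun y => Ψ (Function.update X i y) := by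
  have h : StronglyMeasurable (Function.uncurry fun (X : Config N) (x : Space) =>
      (mode ℓ k x : ℂ) * Ψ (Function.update X i x)) := by
    refine Continuous.stronglyMeasurable ?_
    exact (continuous_ofReal.comp ((continuous_mode ℓ k).comp continuous_snd)).mul
      (hΨ.comp (continuous_fst.update i continuous_snd))
  exact (h.integral_prod_right' (ν := volume.restrict (cell ℓ))).measurable

/-- Measurability of `X ↦ ⟨Ψ(X;·ᵢ), Q^L Ψ(X;·ᵢ)⟩`. [folklore] -/
theorem measurable_lowOccupation_update (K ℓ : ℝ) (i : Fin N) {Ψ : Config N → ℂ}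
    (hΨ : Continuous Ψ) :
    Measurable fun X : Config N => lowOccupation K ℓ fun y => Ψ (Function.update X i y) := by
  unfold lowOccupation
  exact Finset.measurable_sum _ fun k _ =>
    (measurable_modeCoeff_update ℓ k i hΨ).enorm.pow_const 2

/-- Measurability of `X ↦ ⟨Ψ(X;·ᵢ), Q^H Ψ(X;·ᵢ)⟩`. [folklore] -/
theorem measurable_highOccupation_update (K ℓ : ℝ) (i : Fin N) {Ψ : Config N → ℂ}
    (hΨ : Continuous Ψ) :
    Measurable fun X : Config N => highOccupation K ℓ fun y => Ψ (Function.update X i y) := by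
  unfold highOccupation
  refine Measurable.tsum fun k => ?_
  by_cases hk : IsHighMode K k
  · simp only [Set.indicator_of_mem (show k ∈ {k | IsHighMode K k} from hk)]
    exact (measurable_modeCoeff_update ℓ k i hΨ).enorm.pow_const 2
  · simp only [Set.indicator_of_notMem (show k ∉ {k | IsHighMode K k} from hk)]
    exact measurable_const

/-- **`n₊ = n₊^L + n₊^H`** in expectation: the depletion functional of
`KineticGapLengthScalesAssembly` (`∑ᵢ ℓ⁻³∫∫|Ψ(X;·ᵢ) - ⟨Ψ(X;·ᵢ)⟩_Λ|²`, i.e. `⟨Ψ, n₊Ψ⟩` with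
`Q = 1 - P`) splits into the low and high occupations, for continuous `Ψ` and `K ≥ 0`.
[cite: FournaisEtAl2024, after (2.11)] -/
theorem depletion_eq_nPlusLow_add_nPlusHigh {K ℓ : ℝ} (hK : 0 ≤ K) (hℓ : 0 < ℓ)
    {Ψ : Config N → ℂ} (hΨ : Continuous Ψ) :
    depletion N ℓ Ψ = nPlusLow K ℓ N Ψ + nPlusHigh K ℓ N Ψ := by
  unfold depletion nPlusLow nPlusHigh
  rw [← Finset.sum_add_distrib]
  refine Finset.sum_congr rfl fun i _ => ?_
  rw [← mul_add, ← lintegral_add_left (measurable_lowOccupation_update K ℓ i hΨ)]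
  congr 1
  refine lintegral_congr fun X => ?_
  have h := lowOccupation_add_highOccupation_eq hK hℓ
    (f := fun y => Ψ (Function.update X i y)) (hΨ.comp (continuous_const.update i continuous_id))
  simp only [enorm_eq_nnnorm] at h
  exact h.symm

/-- **`n₀ + n₊^L + n₊^H = N`** (`P + Q^L + Q^H = 1`) in expectation, for a normalised
Bose-symmetric `C¹` state on the Neumann box `Λ_ℓ^N` and `K ≥ 0`:
`⟨Ψ,n₀Ψ⟩ + ⟨Ψ,n₊^LΨ⟩ + ⟨Ψ,n₊^HΨ⟩ = N` with `⟨Ψ,n₀Ψ⟩ = condensateOccupation`.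
[cite: FournaisEtAl2024, after (2.11)] -/
theorem condensateOccupation_add_nPlusLow_add_nPlusHigh {n : ℕ} {K ℓ : ℝ} (hK : 0 ≤ K)
    (hℓ : 0 < ℓ) (Ψ : NeumannTrialState (n + 1) ℓ)
    (hsymm : ∀ (σ : Equiv.Perm (Fin (n + 1))) (X : Config (n + 1)), Ψ.ψ (X ∘ σ) = Ψ.ψ X) :
    condensateOccupation (n + 1) ℓ Ψ.ψ + nPlusLow K ℓ (n + 1) Ψ.ψ + nPlusHigh K ℓ (n + 1) Ψ.ψ =
      ((n + 1 : ℕ) : ℝ≥0∞) := by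
  rw [add_assoc, ← depletion_eq_nPlusLow_add_nPlusHigh hK hℓ Ψ.contDiff.continuous]
  exact NeumannTrialState.condensateOccupation_add_depletion hℓ Ψ hsymm

/-- **The kinetic spectral gaps, `N`-body** ((2.12) summed over the particles, sharp constants):
for `Ψ ∈ C¹` and `K ≥ 0`,
`(π/ℓ)² ⟨Ψ, n₊^L Ψ⟩ + (K/ℓ)² ⟨Ψ, n₊^H Ψ⟩ ≤ ∫_{Λ^N} |∇Ψ|² = ⟨Ψ, ∑ⱼ(-Δⱼ)Ψ⟩` — whence
`∑ⱼ 𝒯ⱼ = ∑ⱼ(-Δⱼ) - (π/2ℓ²)n₊ - (K_H/ℓ²)n₊^H ≥ 0` for `K_H ≥ 2`. [cite: FournaisEtAl2024, (2.12)] -/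
theorem gap_mul_nPlusLow_add_mul_nPlusHigh_le {K ℓ : ℝ} (hK : 0 ≤ K) (hℓ : 0 < ℓ)
    {Ψ : Config N → ℂ} (hΨ : ContDiff ℝ 1 Ψ) :
    ENNReal.ofReal ((π / ℓ) ^ 2) * nPlusLow K ℓ N Ψ +
        ENNReal.ofReal ((K / ℓ) ^ 2) * nPlusHigh K ℓ N Ψ ≤
      ∫⁻ X in cellN N ℓ, kineticDensity Ψ X := by
  rw [← sum_lintegral_gradSqC_slice hℓ (hΨ.differentiable one_ne_zero)]
  unfold nPlusLow nPlusHigh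
  rw [Finset.mul_sum, Finset.mul_sum, ← Finset.sum_add_distrib]
  refine Finset.sum_le_sum fun i _ => ?_
  rw [mul_left_comm, mul_left_comm (ENNReal.ofReal ((K / ℓ) ^ 2)), ← mul_add]
  gcongr
  rw [← lintegral_const_mul _ (measurable_lowOccupation_update K ℓ i hΨ.continuous),
    ← lintegral_const_mul _ (measurable_highOccupation_update K ℓ i hΨ.continuous),
    ← lintegral_add_left ((measurable_lowOccupation_update K ℓ i hΨ.continuous).const_mul _)]
  refine lintegral_mono fun X => ?_
  exact gap_mul_lowOccupation_add_mul_highOccupation_le hK hℓ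
    (hΨ.comp (contDiff_update 1 X i))

/-- The same on the open Neumann box `Λ_ℓ^N = (0,ℓ)^{3N}` (a.e. equal to the cell), in particular
`≤ neumannEnergy v Ψ` for every Neumann trial state. [cite: FournaisEtAl2024, (2.12)] -/
theorem gap_mul_nPlusLow_add_mul_nPlusHigh_le_neumannEnergy {K ℓ : ℝ} (hK : 0 ≤ K) (hℓ : 0 < ℓ)
    (v : ℝ → ℝ≥0∞) (Ψ : NeumannTrialState N ℓ) :
    ENNReal.ofReal ((π / ℓ) ^ 2) * nPlusLow K ℓ N Ψ.ψ +
        ENNReal.ofReal ((K / ℓ) ^ 2) * nPlusHigh K ℓ N Ψ.ψ ≤ neumannEnergy v Ψ := by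
  refine (gap_mul_nPlusLow_add_mul_nPlusHigh_le hK hℓ Ψ.contDiff).trans ?_
  rw [← setLIntegral_congr (boxN_ae_eq_cellN N ℓ), neumannEnergy]
  exact lintegral_mono fun X => le_self_add

/-- In particular **`⟨Ψ, n₊^H Ψ⟩ ≤ (ℓ/K_H)² ⟨Ψ, ∑ⱼ(-Δⱼ) Ψ⟩`** (`K_H > 0`): high excitations cost
kinetic energy `> K_H²/ℓ²` each. [cite: FournaisEtAl2024, (2.12)] -/
theorem nPlusHigh_le_mul_lintegral_kineticDensity {K ℓ : ℝ} (hK : 0 < K) (hℓ : 0 < ℓ)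
    {Ψ : Config N → ℂ} (hΨ : ContDiff ℝ 1 Ψ) :
    nPlusHigh K ℓ N Ψ ≤ ENNReal.ofReal ((ℓ / K) ^ 2) * ∫⁻ X in cellN N ℓ, kineticDensity Ψ X := by
  have h := (le_add_left le_rfl).trans (gap_mul_nPlusLow_add_mul_nPlusHigh_le hK.le hℓ hΨ)
  have hc : ENNReal.ofReal ((K / ℓ) ^ 2) ≠ 0 := by
    rw [Ne, ENNReal.ofReal_eq_zero, not_le]; positivity
  have hinv : ENNReal.ofReal ((ℓ / K) ^ 2) * ENNReal.ofReal ((K / ℓ) ^ 2) = 1 := by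
    rw [← ENNReal.ofReal_mul (sq_nonneg _), ← mul_pow, div_mul_div_comm, mul_comm ℓ K,
      div_self (by positivity), one_pow, ENNReal.ofReal_one]
  calc nPlusHigh K ℓ N Ψ
      = ENNReal.ofReal ((ℓ / K) ^ 2) * (ENNReal.ofReal ((K / ℓ) ^ 2) * nPlusHigh K ℓ N Ψ) := by
        rw [← mul_assoc, hinv, one_mul]
    _ ≤ ENNReal.ofReal ((ℓ / K) ^ 2) * ∫⁻ X in cellN N ℓ, kineticDensity Ψ X := by gcongr

/-- **`⟨Ψ, n₊^L Ψ⟩ + ⟨Ψ, n₊^H Ψ⟩ = ⟨Ψ, n₊Ψ⟩ ≤ N`** for a normalised Bose-symmetric Neumann state.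
[cite: FournaisEtAl2024, after (2.11)] -/
theorem nPlusLow_add_nPlusHigh_le {n : ℕ} {K ℓ : ℝ} (hK : 0 ≤ K) (hℓ : 0 < ℓ)
    (Ψ : NeumannTrialState (n + 1) ℓ)
    (hsymm : ∀ (σ : Equiv.Perm (Fin (n + 1))) (X : Config (n + 1)), Ψ.ψ (X ∘ σ) = Ψ.ψ X) :
    nPlusLow K ℓ (n + 1) Ψ.ψ + nPlusHigh K ℓ (n + 1) Ψ.ψ ≤ ((n + 1 : ℕ) : ℝ≥0∞) := by
  rw [← condensateOccupation_add_nPlusLow_add_nPlusHigh hK hℓ Ψ hsymm, add_assoc]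
  exact le_add_left le_rfl

end NBody

end Literature.MathematicalPhysics.QuantumManyBody.NeumannBox

end
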